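import Literature.Topology.FourManifolds.ComplexProjectiveSpaceProofs
import Literature.Topology.FourManifolds.MorseChartChange
import Mathlib.Analysis.InnerProductSpace.Calculus
import Mathlib.Analysis.Normed.Module.Ball.Homeomorph
import Mathlib.Geometry.Manifold.ContMDiff.Atlas
import HarnessLib

/-!
# A Morse function on `ℂℙⁿ` with exactly `n + 1` critical points

Topic `Literature/Topology/FourManifolds` (fact seat
`provefact-Literature.Topology.FourManifolds.unorientedBordismClass_mk_complexProjectivePlane_ne_zero`:
the count of critical points of a Morse function on `ℂℙ²` is what makes `χ(ℂℙ²)` odd, see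
`BordismFourUnorientedProofs.lean`).  Everything here is **proved**; no definition and no named
fact is introduced (the function and its weights are bound inside the final existence theorem,
the auxiliary lemmas take the function `h` together with its defining equation `hh`).

J. Milnor, *Morse theory*, Ann. of Math. Studies 51 (1963), §4, Example (pp. 25–27): on
`ℂℙⁿ = {[z₀ : ⋯ : zₙ]}` the function `f = Σ cⱼ |zⱼ|² / Σ |zⱼ|²` with pairwise distinct real
constants `cⱼ` is a Morse function whose critical points are the `n + 1` coordinate points
`[0 : ⋯ : 1 : ⋯ : 0]` (of index twice the number of `cₖ < cⱼ`).  We prove the part of this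
statement that does not involve the index:

* `ComplexProjectiveSpace.exists_isMorse_ncard_criticalSet_eq` — **for every `n` there is a
  Morse function on `ℂℙⁿ` (the tree's `Literature.Topology.FourManifolds.ComplexProjectiveSpace n`, real-analytic
  `2n`-manifold through its `n + 1` affine charts, model `𝓡 (2 * n)`) with exactly `n + 1`
  critical points and values in `(0, 1)`**, namely the weighted height function
  `h[v] = (Σₖ cₖ ‖vₖ‖²) / (Σₖ ‖vₖ‖²)` with `cₖ = (k + 1)/(n + 2)`.

## Proof

The computation is organised so that no second derivative of a rational function is ever
taken.  In the *modified* affine chart `eᵢ = affineChart i ≫ univUnitBall` (affine coordinates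
`w = (zⱼ/zᵢ)ⱼ ∈ ℂⁿ ≅ ℝ²ⁿ` followed by Mathlib's radial diffeomorphism
`OpenPartialHomeomorph.univUnitBall : ℝ²ⁿ ≅ 𝔹`, `x ↦ (1 + ‖x‖²)^{-1/2} x`), the height function is
*exactly* the diagonal quadratic polynomial
`h ∘ eᵢ⁻¹ (u) = cᵢ + Σⱼ (c_{i↑j} - cᵢ) ‖wⱼ(u)‖²` on the unit ball
(`height_trans_univUnitBall_symm_apply`; indeed `‖wⱼ(u)‖² = |zⱼ|²/Σ|zₖ|²`).  The chart `eᵢ`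
belongs to the `C^∞` maximal atlas (`affineChart_trans_univUnitBall_mem_maximalAtlas`), so
critical points and the nondegeneracy of the Hessian may be read in it (the tree's
`isMCriticalPt_iff_fderiv_comp_extend_symm_eq_zero`, `nondegenerate_mhessian_iff`,
`MorseChartChange.lean`; Milnor 1963, §2): the derivative of the model at `u` is
`v ↦ Σⱼ (c_{i↑j} - cᵢ) · 2⟪wⱼ(u), wⱼ(v)⟫` (`hasFDerivAt_heightModel`), which vanishes only at
`u = 0` since the weights are pairwise distinct (test against the vector with the single complex
coordinate `wⱼ(u)`, `eq_zero_of_heightModelDeriv_apply_eq_zero`) — so the critical points in the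
`i`-th chart are exactly its centre (`isMCriticalPt_height_iff`, `criticalSet_height`) — and the
second derivative is the constant nondegenerate form
`(v, w) ↦ Σⱼ (c_{i↑j} - cᵢ) · 2⟪wⱼ(v), wⱼ(w)⟫` (`fderiv_fderiv_heightModel_apply_apply`,
`nondegenerate_mhessian_height`).  Smoothness of `h` is read in the plain affine charts, where
it is a rational function with denominator `1 + ‖w‖² ≥ 1` (`contMDiff_height`, through the
tree's `contMDiff_of_contDiff_comp_affineChart_symm`).

## References

* J. Milnor, *Morse theory*, Ann. of Math. Studies 51, Princeton (1963), §2 (nondegeneracy and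
  index do not depend on the coordinates), §4 Example `ℂℙⁿ` (pp. 25–27). [Milnor1963]
* J. Milnor, J. Stasheff, *Characteristic classes*, Ann. of Math. Studies 76 (1974), §14
  (`ℂℙⁿ`). [MilnorStasheffAMS76]
-/

open scoped Manifold ContDiff Topology RealInnerProductSpace
open Set Function Metric Module Filter

noncomputable section

namespace Literature.Topology.FourManifolds

namespace ComplexProjectiveSpace

variable {n : ℕ}

/-! #### Real coordinates -/

/-- The `j`-th complex coordinate of `(realCoordinates n)⁻¹ x` has real part `x (0, j)` and
imaginary part `x (1, j)` (slots through `finProdFinEquiv`). [folklore] -/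
theorem realCoordinates_symm_apply (x : EuclideanSpace ℝ (Fin (2 * n))) (j : Fin n) :
    (realCoordinates n).symm x j = ⟨x (finProdFinEquiv (0, j)), x (finProdFinEquiv (1, j))⟩ :=
  rfl

/-- `‖((realCoordinates n)⁻¹ x)_j‖² = x(0,j)² + x(1,j)²`. [folklore] -/
theorem norm_sq_realCoordinates_symm_apply (x : EuclideanSpace ℝ (Fin (2 * n))) (j : Fin n) :
    ‖(realCoordinates n).symm x j‖ ^ 2 =
      x (finProdFinEquiv (0, j)) ^ 2 + x (finProdFinEquiv (1, j)) ^ 2 := by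
  rw [realCoordinates_symm_apply, Complex.sq_norm, Complex.normSq_mk, sq, sq]

/-- The realification `realCoordinates n : ℂⁿ ≃ ℝ²ⁿ` is compatible with the Euclidean norms:
`Σⱼ ‖((realCoordinates n)⁻¹ x)_j‖² = ‖x‖²`. [folklore] -/
theorem sum_norm_sq_realCoordinates_symm (x : EuclideanSpace ℝ (Fin (2 * n))) :
    ∑ j, ‖(realCoordinates n).symm x j‖ ^ 2 = ‖x‖ ^ 2 := by
  simp_rw [norm_sq_realCoordinates_symm_apply, Finset.sum_add_distrib]
  rw [EuclideanSpace.real_norm_sq_eq, ← Equiv.sum_comp finProdFinEquiv, Fintype.sum_prod_type,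
    Fin.sum_univ_two]

/-! #### Homogeneous coordinates of the affine charts -/

/-- In the `i`-th affine chart the weighted square norm of the homogeneous coordinates is
`cᵢ + Σⱼ c_{i↑j} ‖wⱼ‖²`. [folklore] -/
theorem sum_mul_norm_sq_homogenize (c : Fin (n + 1) → ℝ) (i : Fin (n + 1)) (w : Fin n → ℂ) :
    ∑ k, c k * ‖(homogenize i w : Fin (n + 1) → ℂ) k‖ ^ 2 =
      c i + ∑ j, c (i.succAbove j) * ‖w j‖ ^ 2 := by
  rw [Fin.sum_univ_succAbove _ i]
  simp [homogenize]

/-- In the `i`-th affine chart the square norm of the homogeneous coordinates is `1 + Σⱼ ‖wⱼ‖²`.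
[folklore] -/
theorem sum_norm_sq_homogenize (i : Fin (n + 1)) (w : Fin n → ℂ) :
    ∑ k, ‖(homogenize i w : Fin (n + 1) → ℂ) k‖ ^ 2 = 1 + ∑ j, ‖w j‖ ^ 2 := by
  rw [Fin.sum_univ_succAbove _ i]
  simp [homogenize]


/-! #### The weighted height function in the modified affine charts -/

section Height

variable {c : Fin (n + 1) → ℝ} {h : ComplexProjectiveSpace n → ℝ}

/-- **The height function read in the chart `affineChart i ≫ univUnitBall` is a diagonal
quadratic polynomial**: for `u` in the unit ball,
`h(e⁻¹ u) = cᵢ + Σⱼ (c_{i↑j} - cᵢ) ‖((realCoordinates n)⁻¹ u)_j‖²`, where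
`h[v] = (Σ cₖ ‖vₖ‖²) / (Σ ‖vₖ‖²)` (Milnor, *Morse theory* (1963), §4, Example p. 26: the
functions `|z_j|²/Σ|z_k|²` on `ℂℙⁿ`). [cite: Milnor1963, §4 (example: ℂℙⁿ, pp. 25–27)] -/
theorem height_trans_univUnitBall_symm_apply
    (hh : ∀ v, h (mk v) = (∑ k, c k * ‖(v : Fin (n + 1) → ℂ) k‖ ^ 2) / ∑ k, ‖(v : Fin (n + 1) → ℂ) k‖ ^ 2)
    (i : Fin (n + 1)) {u : EuclideanSpace ℝ (Fin (2 * n))} (hu : u ∈ ball (0 : EuclideanSpace ℝ (Fin (2 * n))) 1) :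
    h (((affineChart i).trans OpenPartialHomeomorph.univUnitBall).symm u) =
      c i + ∑ j, (c (i.succAbove j) - c i) * ‖(realCoordinates n).symm u j‖ ^ 2 := by
  have hu1 : ‖u‖ ^ 2 < 1 := by
    rw [mem_ball_zero_iff] at hu
    nlinarith [norm_nonneg u]
  have hu1' : 1 - ‖u‖ ^ 2 ≠ 0 := by linarith
  rw [OpenPartialHomeomorph.coe_trans_symm, comp_apply,
    OpenPartialHomeomorph.univUnitBall_symm_apply, affineChart_symm_apply, hh,
    sum_mul_norm_sq_homogenize, sum_norm_sq_homogenize]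
  set s : ℝ := (√(1 - ‖u‖ ^ 2))⁻¹ with hs
  have hs2 : s ^ 2 * (1 - ‖u‖ ^ 2) = 1 := by
    rw [hs, inv_pow, Real.sq_sqrt (by linarith)]
    field_simp
  have hsm : ∀ j, ‖(realCoordinates n).symm (s • u) j‖ ^ 2 =
      s ^ 2 * ‖(realCoordinates n).symm u j‖ ^ 2 := fun j => by
    rw [map_smul, Pi.smul_apply, norm_smul, mul_pow, Real.norm_eq_abs, sq_abs]
  simp_rw [hsm, ← Finset.mul_sum, sum_norm_sq_realCoordinates_symm]
  have hD : 1 + s ^ 2 * ‖u‖ ^ 2 = s ^ 2 := by linarith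
  have hs0 : s ^ 2 ≠ 0 := by
    intro h0; rw [h0] at hs2; simp at hs2
  have key : ∑ x, c (i.succAbove x) * (s ^ 2 * ‖(realCoordinates n).symm u x‖ ^ 2) =
      s ^ 2 * ∑ x, c (i.succAbove x) * ‖(realCoordinates n).symm u x‖ ^ 2 := by
    rw [Finset.mul_sum]
    exact Finset.sum_congr rfl fun x _ => by ring
  rw [hD, add_div, key, mul_div_cancel_left₀ _ hs0,
    show c i / s ^ 2 = c i * (1 - ‖u‖ ^ 2) by
      rw [div_eq_iff hs0]; linear_combination (-(c i)) * hs2]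
  rw [← sum_norm_sq_realCoordinates_symm u, mul_sub, mul_one, Finset.mul_sum]
  simp_rw [sub_mul]
  rw [Finset.sum_sub_distrib]
  ring

end Height


/-! #### Calculus of the diagonal quadratic model `cᵢ + Σⱼ aⱼ ‖wⱼ‖²` on `ℝ²ⁿ` -/

section Model

variable (c : Fin (n + 1) → ℝ) (i : Fin (n + 1))

/-- The derivative of the diagonal quadratic model `u ↦ cᵢ + Σⱼ (c_{i↑j} - cᵢ) ‖wⱼ(u)‖²`,
`w(u) = (realCoordinates n)⁻¹ u`: `v ↦ Σⱼ (c_{i↑j} - cᵢ) · 2⟪wⱼ(u), wⱼ(v)⟫`. [folklore] -/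
theorem hasFDerivAt_heightModel (u : EuclideanSpace ℝ (Fin (2 * n))) :
    HasFDerivAt
      (fun u : EuclideanSpace ℝ (Fin (2 * n)) => c i + ∑ j, (c (i.succAbove j) - c i) * ‖(realCoordinates n).symm u j‖ ^ 2)
      (∑ j, (c (i.succAbove j) - c i) •
        ((2 : ℕ) • (innerSL ℝ ((realCoordinates n).symm u j)).comp ((ContinuousLinearMap.proj (R := ℝ) (φ := fun _ : Fin n => ℂ) j).comp
          ((realCoordinates n).symm : EuclideanSpace ℝ (Fin (2 * n)) →L[ℝ] (Fin n → ℂ))))) u := by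
  refine HasFDerivAt.const_add (c i) (HasFDerivAt.fun_sum fun j _ => ?_)
  have hP : HasFDerivAt (fun u : EuclideanSpace ℝ (Fin (2 * n)) => (realCoordinates n).symm u j) ((ContinuousLinearMap.proj (R := ℝ) (φ := fun _ : Fin n => ℂ) j).comp
          ((realCoordinates n).symm : EuclideanSpace ℝ (Fin (2 * n)) →L[ℝ] (Fin n → ℂ))) u :=
    (((ContinuousLinearMap.proj (R := ℝ) (φ := fun _ : Fin n => ℂ) j).comp
          ((realCoordinates n).symm : EuclideanSpace ℝ (Fin (2 * n)) →L[ℝ] (Fin n → ℂ)))).hasFDerivAt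
  exact hP.norm_sq.const_mul _

/-- The derivative of the model, evaluated on the vector with a single complex coordinate `z` in
slot `j`. [folklore] -/
theorem heightModelDeriv_apply_single (u : EuclideanSpace ℝ (Fin (2 * n))) (j : Fin n) (z : ℂ) :
    (∑ j, (c (i.succAbove j) - c i) •
        ((2 : ℕ) • (innerSL ℝ ((realCoordinates n).symm u j)).comp ((ContinuousLinearMap.proj (R := ℝ) (φ := fun _ : Fin n => ℂ) j).comp
          ((realCoordinates n).symm : EuclideanSpace ℝ (Fin (2 * n)) →L[ℝ] (Fin n → ℂ)))))
      (realCoordinates n (Pi.single j z)) =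
      (c (i.succAbove j) - c i) * (2 * ⟪(realCoordinates n).symm u j, z⟫) := by
  simp only [sum_apply, smul_apply,
    ContinuousLinearMap.comp_apply, ContinuousLinearEquiv.coe_coe,
    ContinuousLinearEquiv.symm_apply_apply, ContinuousLinearMap.proj_apply, innerSL_apply_apply,
    smul_eq_mul, nsmul_eq_mul, Nat.cast_ofNat]
  rw [Finset.sum_eq_single j (fun k _ hk => by simp [hk]) (by simp)]
  simp

/-- The derivative of the model is a symmetric bilinear expression in `(u, v)`. [folklore] -/
theorem heightModelDeriv_comm (u v : EuclideanSpace ℝ (Fin (2 * n))) :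
    (∑ j, (c (i.succAbove j) - c i) •
        ((2 : ℕ) • (innerSL ℝ ((realCoordinates n).symm u j)).comp ((ContinuousLinearMap.proj (R := ℝ) (φ := fun _ : Fin n => ℂ) j).comp
          ((realCoordinates n).symm : EuclideanSpace ℝ (Fin (2 * n)) →L[ℝ] (Fin n → ℂ))))) v =
      (∑ j, (c (i.succAbove j) - c i) •
        ((2 : ℕ) • (innerSL ℝ ((realCoordinates n).symm v j)).comp ((ContinuousLinearMap.proj (R := ℝ) (φ := fun _ : Fin n => ℂ) j).comp
          ((realCoordinates n).symm : EuclideanSpace ℝ (Fin (2 * n)) →L[ℝ] (Fin n → ℂ))))) u := by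
  simp only [sum_apply, smul_apply,
    ContinuousLinearMap.comp_apply, ContinuousLinearEquiv.coe_coe, ContinuousLinearMap.proj_apply,
    innerSL_apply_apply, smul_eq_mul, nsmul_eq_mul]
  exact Finset.sum_congr rfl fun j _ => by rw [real_inner_comm]

/-- **Nondegeneracy of the model**: for pairwise distinct weights, if the derivative expression
at `u` kills every vector, then `u = 0` (each complex coordinate `wⱼ(u)` is tested against
itself). [folklore] -/
theorem eq_zero_of_heightModelDeriv_apply_eq_zero (hc : Injective c) {u : EuclideanSpace ℝ (Fin (2 * n))}
    (h0 : ∀ v, (∑ j, (c (i.succAbove j) - c i) •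
        ((2 : ℕ) • (innerSL ℝ ((realCoordinates n).symm u j)).comp ((ContinuousLinearMap.proj (R := ℝ) (φ := fun _ : Fin n => ℂ) j).comp
          ((realCoordinates n).symm : EuclideanSpace ℝ (Fin (2 * n)) →L[ℝ] (Fin n → ℂ))))) v = 0) :
    u = 0 := by
  have hw : (realCoordinates n).symm u = 0 := by
    funext j
    have h1 := h0 (realCoordinates n (Pi.single j ((realCoordinates n).symm u j)))
    rw [heightModelDeriv_apply_single, real_inner_self_eq_norm_sq, mul_eq_zero] at h1
    rcases h1 with h1 | h1
    · exact absurd (sub_eq_zero.1 h1) fun h => Fin.succAbove_ne i j (hc h)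
    · have : ‖(realCoordinates n).symm u j‖ ^ 2 = 0 := by linarith
      simpa using this
  simpa using hw

/-- The derivative of the model as a continuous linear map of the base point. [folklore] -/
theorem fderiv_heightModel_eq :
    fderiv ℝ (fun u : EuclideanSpace ℝ (Fin (2 * n)) =>
        c i + ∑ j, (c (i.succAbove j) - c i) * ‖(realCoordinates n).symm u j‖ ^ 2) =
      ⇑(∑ j, (c (i.succAbove j) - c i) • ((2 : ℕ) •
        (ContinuousLinearMap.precomp ℝ ((ContinuousLinearMap.proj (R := ℝ) (φ := fun _ : Fin n => ℂ) j).comp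
          ((realCoordinates n).symm : EuclideanSpace ℝ (Fin (2 * n)) →L[ℝ] (Fin n → ℂ)))).comp ((innerSL ℝ).comp ((ContinuousLinearMap.proj (R := ℝ) (φ := fun _ : Fin n => ℂ) j).comp
          ((realCoordinates n).symm : EuclideanSpace ℝ (Fin (2 * n)) →L[ℝ] (Fin n → ℂ)))))) := by
  funext u
  rw [(hasFDerivAt_heightModel c i u).fderiv]
  simp only [sum_apply, smul_apply, ContinuousLinearMap.comp_apply,
    ContinuousLinearMap.precomp_apply, ContinuousLinearMap.proj_apply, ContinuousLinearEquiv.coe_coe]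

/-- **The second derivative of the model** is the constant form
`(v, w) ↦ Σⱼ (c_{i↑j} - cᵢ) · 2⟪wⱼ(v), wⱼ(w)⟫`. [folklore] -/
theorem fderiv_fderiv_heightModel_apply_apply (u v w : EuclideanSpace ℝ (Fin (2 * n))) :
    fderiv ℝ (fderiv ℝ (fun u : EuclideanSpace ℝ (Fin (2 * n)) =>
        c i + ∑ j, (c (i.succAbove j) - c i) * ‖(realCoordinates n).symm u j‖ ^ 2)) u v w =
      (∑ j, (c (i.succAbove j) - c i) •
        ((2 : ℕ) • (innerSL ℝ ((realCoordinates n).symm v j)).comp ((ContinuousLinearMap.proj (R := ℝ) (φ := fun _ : Fin n => ℂ) j).comp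
          ((realCoordinates n).symm : EuclideanSpace ℝ (Fin (2 * n)) →L[ℝ] (Fin n → ℂ))))) w := by
  rw [fderiv_heightModel_eq, ContinuousLinearMap.fderiv]
  simp only [sum_apply, smul_apply, ContinuousLinearMap.comp_apply,
    ContinuousLinearMap.precomp_apply, ContinuousLinearMap.proj_apply, ContinuousLinearEquiv.coe_coe]

end Model


/-! #### The height function on `ℂℙⁿ`: smoothness, critical points, nondegeneracy -/

section Manifold

variable {c : Fin (n + 1) → ℝ} {h : ComplexProjectiveSpace n → ℝ}

/-- The centre `[0 : ⋯ : 1 : ⋯ : 0]` (the `1` in slot `i`) of the `i`-th affine chart lies in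
that chart. [folklore] -/
theorem coordNeZero_affineChart_symm_zero (i : Fin (n + 1)) :
    CoordNeZero i ((affineChart i).symm (0 : EuclideanSpace ℝ (Fin (2 * n)))) :=
  (affineChart i).map_target (mem_univ _)

/-- The centre of the `i`-th affine chart has affine coordinates `0`. [folklore] -/
theorem affineChart_affineChart_symm_zero (i : Fin (n + 1)) :
    affineChart i ((affineChart i).symm (0 : EuclideanSpace ℝ (Fin (2 * n)))) = 0 :=
  (affineChart i).right_inv (mem_univ _)

/-- The `n + 1` chart centres `[0 : ⋯ : 1 : ⋯ : 0]` of `ℂℙⁿ` are pairwise distinct. [folklore] -/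
theorem affineChart_symm_zero_injective :
    Injective fun i : Fin (n + 1) => (affineChart i).symm (0 : EuclideanSpace ℝ (Fin (2 * n))) := by
  intro i j hij
  have hi : CoordNeZero i ((affineChart j).symm (0 : EuclideanSpace ℝ (Fin (2 * n)))) := by
    have := coordNeZero_affineChart_symm_zero (n := n) i
    simp only at hij
    rwa [hij] at this
  rw [affineChart_symm_apply, map_zero, coordNeZero_mk] at hi
  rcases Fin.eq_self_or_eq_succAbove j i with rfl | ⟨k, rfl⟩
  · rfl
  · exact absurd (by simp [homogenize]) hi

/-- The modified chart `affineChart i ≫ univUnitBall` (affine coordinates followed by the radial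
diffeomorphism of `ℝ²ⁿ` onto its unit ball) belongs to the `C^∞` maximal atlas of `ℂℙⁿ`.
[folklore] -/
theorem affineChart_trans_univUnitBall_mem_maximalAtlas (i : Fin (n + 1)) :
    (affineChart i).trans OpenPartialHomeomorph.univUnitBall ∈
      IsManifold.maximalAtlas (𝓡 (2 * n)) ∞ (ComplexProjectiveSpace n) := by
  have he : affineChart i ∈ IsManifold.maximalAtlas (𝓡 (2 * n)) ∞ (ComplexProjectiveSpace n) :=
    IsManifold.subset_maximalAtlas ⟨i, rfl⟩
  rw [IsManifold.mem_maximalAtlas_iff_contMDiffOn, OpenPartialHomeomorph.coe_trans,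
    OpenPartialHomeomorph.coe_trans_symm, OpenPartialHomeomorph.trans_source,
    OpenPartialHomeomorph.trans_target]
  constructor
  · exact (contMDiffOn_iff_contDiffOn.2
      OpenPartialHomeomorph.contDiff_univUnitBall.contDiffOn).comp
      ((contMDiffOn_of_mem_maximalAtlas he).mono inter_subset_left) fun x hx => hx.2
  · exact (contMDiffOn_symm_of_mem_maximalAtlas he).comp
      ((contMDiffOn_iff_contDiffOn.2 OpenPartialHomeomorph.contDiffOn_univUnitBall_symm).mono
        inter_subset_left) fun x hx => hx.2

/-- The source of the modified chart is the source `{[v] | vᵢ ≠ 0}` of the affine chart.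
[folklore] -/
theorem affineChart_trans_univUnitBall_source (i : Fin (n + 1)) :
    ((affineChart i).trans OpenPartialHomeomorph.univUnitBall).source =
      {p : ComplexProjectiveSpace n | CoordNeZero i p} := by
  rw [OpenPartialHomeomorph.trans_source, affineChart_source,
    OpenPartialHomeomorph.univUnitBall_source, preimage_univ, inter_univ]

/-- The modified chart maps into the unit ball. [folklore] -/
theorem affineChart_trans_univUnitBall_apply_mem_ball (i : Fin (n + 1))
    (x : ComplexProjectiveSpace n) :
    (affineChart i).trans OpenPartialHomeomorph.univUnitBall x ∈ ball (0 : EuclideanSpace ℝ (Fin (2 * n))) 1 := by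
  rw [OpenPartialHomeomorph.coe_trans, comp_apply]
  exact OpenPartialHomeomorph.univUnitBall.map_source (mem_univ _)

section Height

variable (hh : ∀ v, h (mk v) =
  (∑ k, c k * ‖(v : Fin (n + 1) → ℂ) k‖ ^ 2) / ∑ k, ‖(v : Fin (n + 1) → ℂ) k‖ ^ 2)
include hh

/-- **The weighted height function `h[v] = (Σ cₖ‖vₖ‖²)/(Σ ‖vₖ‖²)` on `ℂℙⁿ` is smooth**: in each
affine chart it is a rational function with non-vanishing denominator (Milnor, *Morse theory*
(1963), §4). [cite: Milnor1963, §4 (example: ℂℙⁿ, pp. 25–27)] -/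
theorem contMDiff_height : ContMDiff (𝓡 (2 * n)) 𝓘(ℝ, ℝ) ∞ h := by
  refine contMDiff_of_contDiff_comp_affineChart_symm fun i => ?_
  have hH := contDiff_coe_homogenize_realCoordinates_symm (n := n) (m := ∞) i
  have heq : h ∘ (affineChart i).symm = fun x : EuclideanSpace ℝ (Fin (2 * n)) =>
      (∑ k, c k * ‖((homogenize i ((realCoordinates n).symm x) :
          {v : Fin (n + 1) → ℂ // v ≠ 0}) : Fin (n + 1) → ℂ) k‖ ^ 2) /
        ∑ k, ‖((homogenize i ((realCoordinates n).symm x) :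
          {v : Fin (n + 1) → ℂ // v ≠ 0}) : Fin (n + 1) → ℂ) k‖ ^ 2 := by
    funext x
    rw [comp_apply, affineChart_symm_apply, hh]
  rw [heq]
  have hk : ∀ k, ContDiff ℝ ∞ fun x : EuclideanSpace ℝ (Fin (2 * n)) =>
      ‖((homogenize i ((realCoordinates n).symm x) :
          {v : Fin (n + 1) → ℂ // v ≠ 0}) : Fin (n + 1) → ℂ) k‖ ^ 2 :=
    fun k => (contDiff_norm_sq ℝ).comp (contDiff_pi.1 hH k)
  refine ContDiff.div (ContDiff.sum fun k _ => contDiff_const.mul (hk k))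
    (ContDiff.sum fun k _ => hk k) fun x => ?_
  rw [sum_norm_sq_homogenize]
  positivity

/-- Near a point of the unit ball, the height function read in the modified chart
`affineChart i ≫ univUnitBall` *is* the diagonal quadratic model. [folklore] -/
theorem height_comp_symm_eventuallyEq (i : Fin (n + 1)) {u : EuclideanSpace ℝ (Fin (2 * n))}
    (hu : u ∈ ball (0 : EuclideanSpace ℝ (Fin (2 * n))) 1) :
    h ∘ ((affineChart i).trans OpenPartialHomeomorph.univUnitBall).symm =ᶠ[𝓝 u]
      fun u : EuclideanSpace ℝ (Fin (2 * n)) =>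
        c i + ∑ j, (c (i.succAbove j) - c i) * ‖(realCoordinates n).symm u j‖ ^ 2 :=
  eventuallyEq_of_mem (isOpen_ball.mem_nhds hu) fun _ hu' =>
    height_trans_univUnitBall_symm_apply hh i hu'

/-- **Critical points of the height function, chart by chart**: for pairwise distinct weights,
a point of the `i`-th affine chart is critical iff it is the centre of that chart (Milnor,
*Morse theory* (1963), §4: "the critical points of `f` are the points where all but one
homogeneous coordinate vanish"). [cite: Milnor1963, §4 (example: ℂℙⁿ, pp. 25–27)] -/
theorem isMCriticalPt_height_iff (hc : Injective c) {i : Fin (n + 1)}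
    {x : ComplexProjectiveSpace n} (hx : CoordNeZero i x) :
    IsMCriticalPt (𝓡 (2 * n)) h x ↔ affineChart i x = 0 := by
  set e := (affineChart i).trans OpenPartialHomeomorph.univUnitBall with he_def
  have hxe : x ∈ e.source := by rw [he_def, affineChart_trans_univUnitBall_source]; exact hx
  have he2 : e ∈ IsManifold.maximalAtlas (𝓡 (2 * n)) 2 (ComplexProjectiveSpace n) :=
    IsManifold.maximalAtlas_subset_of_le (by norm_cast) (affineChart_trans_univUnitBall_mem_maximalAtlas i)
  have hf2 : ContMDiffAt (𝓡 (2 * n)) 𝓘(ℝ, ℝ) 2 h x :=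
    ((contMDiff_height hh).of_le (by norm_cast)).contMDiffAt
  rw [isMCriticalPt_iff_fderiv_comp_extend_symm_eq_zero hf2 he2 hxe]
  have hext : h ∘ (e.extend (𝓡 (2 * n))).symm = h ∘ e.symm := by
    funext y; simp
  have hex : e.extend (𝓡 (2 * n)) x = e x := by simp
  rw [hext, hex, (height_comp_symm_eventuallyEq hh i
    (affineChart_trans_univUnitBall_apply_mem_ball i x)).fderiv_eq,
    (hasFDerivAt_heightModel c i (e x)).fderiv]
  have hex' : e x = OpenPartialHomeomorph.univUnitBall (affineChart i x) := by
    rw [he_def, OpenPartialHomeomorph.coe_trans, comp_apply]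
  constructor
  · intro h0
    have h1 := eq_zero_of_heightModelDeriv_apply_eq_zero c i hc (u := e x) fun v => by
      rw [h0]; rfl
    rw [hex', OpenPartialHomeomorph.univUnitBall_apply] at h1
    exact (smul_eq_zero.1 h1).resolve_left
      (inv_ne_zero (Real.sqrt_ne_zero'.2 (by positivity)))
  · intro h0
    rw [hex', h0, OpenPartialHomeomorph.univUnitBall_apply_zero]
    simp

/-- **The critical set of the height function** with pairwise distinct weights is the set of the
`n + 1` chart centres `[0 : ⋯ : 1 : ⋯ : 0]` (Milnor, *Morse theory* (1963), §4).
[cite: Milnor1963, §4 (example: ℂℙⁿ, pp. 25–27)] -/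
theorem criticalSet_height (hc : Injective c) :
    criticalSet (𝓡 (2 * n)) h = range fun i : Fin (n + 1) => (affineChart i).symm (0 : EuclideanSpace ℝ (Fin (2 * n))) := by
  ext x
  simp only [mem_criticalSet, mem_range]
  constructor
  · intro hx
    obtain ⟨i, hi⟩ := exists_coordNeZero x
    refine ⟨i, ?_⟩
    have h0 := (isMCriticalPt_height_iff hh hc hi).1 hx
    rw [← h0]
    exact (affineChart i).left_inv hi
  · rintro ⟨i, rfl⟩
    exact (isMCriticalPt_height_iff hh hc (coordNeZero_affineChart_symm_zero i)).2
      (affineChart_affineChart_symm_zero i)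

/-- The height function with pairwise distinct weights has exactly `n + 1` critical points.
[cite: Milnor1963, §4 (example: ℂℙⁿ, pp. 25–27)] -/
theorem ncard_criticalSet_height (hc : Injective c) :
    (criticalSet (𝓡 (2 * n)) h).ncard = n + 1 := by
  rw [criticalSet_height hh hc, Set.ncard_range_of_injective affineChart_symm_zero_injective,
    Nat.card_eq_fintype_card, Fintype.card_fin]

/-- **The Hessian of the height function at a critical point is nondegenerate**: read in the
modified chart `affineChart i ≫ univUnitBall` centred at the critical point it is the constant
diagonal form `(v, w) ↦ Σⱼ (c_{i↑j} - cᵢ) · 2⟪wⱼ(v), wⱼ(w)⟫` with non-zero coefficients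
(Milnor, *Morse theory* (1963), §4). [cite: Milnor1963, §4 (example: ℂℙⁿ, pp. 25–27)] -/
theorem nondegenerate_mhessian_height (hc : Injective c) {x : ComplexProjectiveSpace n}
    (hx : IsMCriticalPt (𝓡 (2 * n)) h x) : (mhessian (𝓡 (2 * n)) h x).Nondegenerate := by
  obtain ⟨i, hi⟩ := exists_coordNeZero x
  set e := (affineChart i).trans OpenPartialHomeomorph.univUnitBall with he_def
  have hxe : x ∈ e.source := by rw [he_def, affineChart_trans_univUnitBall_source]; exact hi
  have he2 : e ∈ IsManifold.maximalAtlas (𝓡 (2 * n)) 2 (ComplexProjectiveSpace n) :=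
    IsManifold.maximalAtlas_subset_of_le (by norm_cast) (affineChart_trans_univUnitBall_mem_maximalAtlas i)
  have hf2 : ContMDiffAt (𝓡 (2 * n)) 𝓘(ℝ, ℝ) 2 h x :=
    ((contMDiff_height hh).of_le (by norm_cast)).contMDiffAt
  rw [nondegenerate_mhessian_iff hf2 hx he2 hxe]
  have h0 : affineChart i x = 0 := (isMCriticalPt_height_iff hh hc hi).1 hx
  have hex0 : e.extend (𝓡 (2 * n)) x = 0 := by
    simp [he_def, h0]
  have hext : h ∘ (e.extend (𝓡 (2 * n))).symm = h ∘ e.symm := by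
    funext y; simp
  have hH : ∀ v w, hessianInChart (𝓡 (2 * n)) e h x v w =
      (∑ j, (c (i.succAbove j) - c i) •
        ((2 : ℕ) • (innerSL ℝ ((realCoordinates n).symm v j)).comp ((ContinuousLinearMap.proj (R := ℝ) (φ := fun _ : Fin n => ℂ) j).comp
          ((realCoordinates n).symm : EuclideanSpace ℝ (Fin (2 * n)) →L[ℝ] (Fin n → ℂ))))) w := by
    intro v w
    rw [hessianInChart_apply_apply, hext, hex0, ModelWithCorners.Boundaryless.range_eq_univ,
      fderivWithin_univ, fderivWithin_univ,
      ((height_comp_symm_eventuallyEq hh i (mem_ball_self one_pos)).fderiv).fderiv_eq]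
    exact fderiv_fderiv_heightModel_apply_apply c i 0 v w
  refine ⟨fun v hv => ?_, fun w hw => ?_⟩
  · exact eq_zero_of_heightModelDeriv_apply_eq_zero c i hc fun w => by rw [← hH]; exact hv w
  · exact eq_zero_of_heightModelDeriv_apply_eq_zero c i hc fun v => by
      rw [heightModelDeriv_comm, ← hH]; exact hw v

/-- **The weighted height function with pairwise distinct weights is a Morse function on `ℂℙⁿ`**
(Milnor, *Morse theory* (1963), §4, Example: `ℂℙⁿ`). [cite: Milnor1963, §4 (example: ℂℙⁿ, pp. 25–27)] -/
theorem isMorse_height (hc : Injective c) : IsMorse (𝓡 (2 * n)) h :=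
  ⟨contMDiff_height hh, fun _ hx => nondegenerate_mhessian_height hh hc hx⟩

/-- With weights in `(0, 1)` the height function takes values in `(0, 1)` (it is a convex
combination of the weights). [folklore] -/
theorem height_mem_Ioo (hc0 : ∀ k, 0 < c k) (hc1 : ∀ k, c k < 1) (p : ComplexProjectiveSpace n) :
    h p ∈ Ioo (0 : ℝ) 1 := by
  induction p using ind with
  | h v =>
    rw [hh]
    obtain ⟨k, hk⟩ := Function.ne_iff.1 v.2
    have hk' : 0 < ‖(v : Fin (n + 1) → ℂ) k‖ ^ 2 := by positivity
    have hpos : 0 < ∑ k, ‖(v : Fin (n + 1) → ℂ) k‖ ^ 2 :=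
      Finset.sum_pos' (fun _ _ => by positivity) ⟨k, Finset.mem_univ _, hk'⟩
    constructor
    · exact div_pos (Finset.sum_pos' (fun k _ => mul_nonneg (hc0 k).le (by positivity))
        ⟨k, Finset.mem_univ _, mul_pos (hc0 k) hk'⟩) hpos
    · rw [div_lt_one hpos]
      exact Finset.sum_lt_sum (fun k _ => mul_le_of_le_one_left (by positivity) (hc1 k).le)
        ⟨k, Finset.mem_univ _, mul_lt_of_lt_one_left hk' (hc1 k)⟩

end Height

/-- **`ℂℙⁿ` carries a Morse function with exactly `n + 1` critical points** and values in
`(0, 1)`: the weighted height function `[v] ↦ (Σₖ cₖ ‖vₖ‖²)/(Σₖ ‖vₖ‖²)` with the pairwise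
distinct weights `cₖ = (k + 1)/(n + 2)` (Milnor, *Morse theory* (1963), §4, Example: the
critical points are the coordinate points `[0 : ⋯ : 1 : ⋯ : 0]`, of index `2k`; the indices are
not recorded here). [cite: Milnor1963, §4 (example: ℂℙⁿ, pp. 25–27)] -/
theorem exists_isMorse_ncard_criticalSet_eq (n : ℕ) :
    ∃ f : ComplexProjectiveSpace n → ℝ, IsMorse (𝓡 (2 * n)) f ∧
      (criticalSet (𝓡 (2 * n)) f).ncard = n + 1 ∧ ∀ p, f p ∈ Ioo (0 : ℝ) 1 := by
  set c : Fin (n + 1) → ℝ := fun k => ((k : ℕ) + 1) / ((n : ℝ) + 2) with hc_def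
  have hc : Injective c := by
    intro k l hkl
    simp only [hc_def] at hkl
    rw [div_left_inj' (by positivity), add_left_inj] at hkl
    exact Fin.ext (by exact_mod_cast hkl)
  have hc0 : ∀ k, 0 < c k := fun k => by simp only [hc_def]; positivity
  have hc1 : ∀ k, c k < 1 := fun k => by
    simp only [hc_def]
    rw [div_lt_one (by positivity)]
    have := k.is_lt
    have : ((k : ℕ) : ℝ) + 1 ≤ (n : ℝ) + 1 := by exact_mod_cast this
    linarith
  have key : ∀ (a b : {v : Fin (n + 1) → ℂ // v ≠ 0}) (t : ℂ),
      (a : Fin (n + 1) → ℂ) = t • (b : Fin (n + 1) → ℂ) →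
      (fun v : {v : Fin (n + 1) → ℂ // v ≠ 0} =>
        (∑ k, c k * ‖(v : Fin (n + 1) → ℂ) k‖ ^ 2) / ∑ k, ‖(v : Fin (n + 1) → ℂ) k‖ ^ 2) a =
      (fun v : {v : Fin (n + 1) → ℂ // v ≠ 0} =>
        (∑ k, c k * ‖(v : Fin (n + 1) → ℂ) k‖ ^ 2) / ∑ k, ‖(v : Fin (n + 1) → ℂ) k‖ ^ 2) b := by
    intro a b t hab
    have ht : t ≠ 0 := by rintro rfl; exact a.2 (by simpa using hab)
    have ht' : ‖t‖ ^ 2 ≠ 0 := pow_ne_zero 2 (norm_ne_zero_iff.2 ht)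
    simp only [hab, Pi.smul_apply, smul_eq_mul, norm_mul, mul_pow]
    rw [show ∑ k, c k * (‖t‖ ^ 2 * ‖(b : Fin (n + 1) → ℂ) k‖ ^ 2) =
        ‖t‖ ^ 2 * ∑ k, c k * ‖(b : Fin (n + 1) → ℂ) k‖ ^ 2 by
      rw [Finset.mul_sum]; exact Finset.sum_congr rfl fun k _ => by ring,
      ← Finset.mul_sum, mul_div_mul_left _ _ ht']
  set f : ComplexProjectiveSpace n → ℝ := Projectivization.lift _ key with hf_def
  have hf : ∀ v, f (mk v) =
      (∑ k, c k * ‖(v : Fin (n + 1) → ℂ) k‖ ^ 2) / ∑ k, ‖(v : Fin (n + 1) → ℂ) k‖ ^ 2 :=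
    fun v => rfl
  exact ⟨f, isMorse_height hf hc, ncard_criticalSet_height hf hc, height_mem_Ioo hf hc0 hc1⟩

end Manifold

end ComplexProjectiveSpace

end Literature.Topology.FourManifolds
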